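import Literature.Analysis.Calculus.SphereDivergence
import HarnessLib

/-!
# Calculus of spherical integrals for integrands smooth away from the origin

Analysis support file (everything proved; no definitions, no named facts) for the cylindrical
coordinates of A. Waldron, *Long-time existence for Yang–Mills flow*, Invent. math. 217 (2019),
§4–§5: Waldron's component functions `f²(r,t) = r⁴∫_{S³}|F(t)|²(rθ)dΘ`, `f₁, f₂, g, g₁, g₂, g₃`
are spherical integrals (tree: `Literature.Analysis.FluidPDE.sphereIntegral`) of integrands that
are smooth only on `(ℝ⁴ ∖ {0}) × [0, T)`, and the differential inequalities `□f₁ ≤ …` require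
their derivatives in the radius `r > 0` and in the time parameter. The tree's
`hasDerivAt_sphereIntegral` assumes a globally `C¹` integrand; here:

* `hasDerivAt_sphereIntegral_of_contDiffOn` — for `f` of class `C¹` on `{0}ᶜ` and `r > 0`,
  `d/dr ∫_S f(rθ) dσ = ∫_S Df(rθ)θ dσ`, and `hasDerivAt_sphereIntegral_radial_of_contDiffOn`,
  the same with the radial derivative `∂ᵣf(x) = Df(x)(x/‖x‖)`;
* `hasDerivAt_sphereIntegral_param` — for a family `q : ℝ → E → ℝ` jointly `C¹` on
  `𝒯 × {0}ᶜ` (`𝒯` open) and `r > 0`, `t ↦ ∫_S q(t, rθ) dσ` is differentiable on `𝒯` with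
  derivative `∫_S ∂ₜq(t, rθ) dσ`.

References: A. Waldron, Invent. math. 217 (2019), §4.2–4.3 [Waldron2019]; (differentiation
under the integral sign) [folklore].
-/

noncomputable section

open MeasureTheory Set Metric Filter
open scoped Topology RealInnerProductSpace

namespace Literature.Analysis.Calculus

variable {E : Type*} [NormedAddCommGroup E] [InnerProductSpace ℝ E] [FiniteDimensional ℝ E]
  [MeasurableSpace E] [BorelSpace E]

omit [FiniteDimensional ℝ E] [MeasurableSpace E] [BorelSpace E] in
/-- Points `ρ • θ` with `θ` on the unit sphere and `ρ` in a compact positive range stay in a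
compact set away from the origin. [folklore] -/
theorem smul_sphere_mem_shell {a b ρ : ℝ} (hρ : ρ ∈ Icc a b) (θ : sphere (0 : E) 1) (ha : 0 < a) :
    ρ • (θ : E) ∈ {x : E | a ≤ ‖x‖ ∧ ‖x‖ ≤ b} := by
  have hρ0 : 0 ≤ ρ := ha.le.trans hρ.1
  simp only [mem_setOf_eq, norm_smul, Real.norm_eq_abs, abs_of_nonneg hρ0, norm_eq_of_mem_sphere,
    mul_one]
  exact hρ

omit [MeasurableSpace E] [BorelSpace E] in
/-- The closed shell `{a ≤ ‖x‖ ≤ b}` is compact and, for `a > 0`, misses the origin. [folklore] -/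
theorem isCompact_shell_closed (a b : ℝ) : IsCompact {x : E | a ≤ ‖x‖ ∧ ‖x‖ ≤ b} := by
  have : {x : E | a ≤ ‖x‖ ∧ ‖x‖ ≤ b} = closedBall (0 : E) b \ ball 0 a := by
    ext x; simp [and_comm]
  rw [this]
  exact (isCompact_closedBall 0 b).diff isOpen_ball

omit [MeasurableSpace E] [BorelSpace E] [FiniteDimensional ℝ E] [InnerProductSpace ℝ E] in
/-- For `a > 0` the closed shell misses the origin. [folklore] -/
theorem shell_closed_subset_compl_zero {a b : ℝ} (ha : 0 < a) :
    {x : E | a ≤ ‖x‖ ∧ ‖x‖ ≤ b} ⊆ ({0}ᶜ : Set E) := fun x hx h0 => by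
  have : ‖x‖ = 0 := by rw [show x = 0 from h0, norm_zero]
  linarith [hx.1]

/-- **Differentiating the sphere integral in the radius, for integrands smooth away from the
origin.** For `f` of class `C¹` on `{0}ᶜ` and `r > 0`,
`d/dr ∫_S f(rθ) dσ(θ) = ∫_S Df(rθ) θ dσ(θ)`. [folklore] -/
theorem hasDerivAt_sphereIntegral_of_contDiffOn [Nontrivial E] {f : E → ℝ}
    (hf : ContDiffOn ℝ 1 f {0}ᶜ) {r : ℝ} (hr : 0 < r) :
    HasDerivAt (Literature.Analysis.FluidPDE.sphereIntegral (volume : Measure E) f)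
      (∫ θ : sphere (0 : E) 1, fderiv ℝ f (r • (θ : E)) (θ : E) ∂(volume : Measure E).toSphere) r := by
  have hO : IsOpen ({0}ᶜ : Set E) := isOpen_compl_singleton
  have hfd : ∀ x ∈ ({0}ᶜ : Set E), HasFDerivAt f (fderiv ℝ f x) x := fun x hx =>
    ((hf.differentiableOn one_ne_zero).differentiableAt (hO.mem_nhds hx)).hasFDerivAt
  have hfc : ContinuousOn f {0}ᶜ := hf.continuousOn
  have hDfc : ContinuousOn (fun x => fderiv ℝ f x) {0}ᶜ := hf.continuousOn_fderiv_of_isOpen hO le_rfl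
  -- the compact shell `r/2 ≤ ‖x‖ ≤ 2r` and a bound for `Df` there
  set K : Set E := {x : E | r / 2 ≤ ‖x‖ ∧ ‖x‖ ≤ 2 * r} with hK
  have hKc : IsCompact K := isCompact_shell_closed (r / 2) (2 * r)
  have hK0 : K ⊆ ({0}ᶜ : Set E) := shell_closed_subset_compl_zero (by positivity)
  obtain ⟨C, hC⟩ := hKc.exists_bound_of_continuousOn (hDfc.mono hK0)
  have hs : Ioo (r / 2) (2 * r) ∈ 𝓝 r := Ioo_mem_nhds (by linarith) (by linarith)
  -- continuity of the slices
  have hmem : ∀ {ρ : ℝ}, ρ ∈ Ioo (r / 2) (2 * r) → ∀ θ : sphere (0 : E) 1, ρ • (θ : E) ∈ K :=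
    fun hρ θ => smul_sphere_mem_shell ⟨hρ.1.le, hρ.2.le⟩ θ (by positivity)
  have hne : ∀ {ρ : ℝ}, 0 < ρ → ∀ θ : sphere (0 : E) 1, ρ • (θ : E) ∈ ({0}ᶜ : Set E) := by
    intro ρ hρ θ
    simp only [mem_compl_iff, mem_singleton_iff, smul_eq_zero, not_or]
    exact ⟨hρ.ne', ne_zero_of_mem_unit_sphere θ⟩
  have hslice : ∀ {ρ : ℝ}, 0 < ρ → Continuous fun θ : sphere (0 : E) 1 => f (ρ • (θ : E)) :=
    fun hρ => hfc.comp_continuous (continuous_const.smul continuous_subtype_val) (hne hρ)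
  have hslice' : ∀ {ρ : ℝ}, 0 < ρ →
      Continuous fun θ : sphere (0 : E) 1 => fderiv ℝ f (ρ • (θ : E)) (θ : E) := fun hρ =>
    (hDfc.comp_continuous (continuous_const.smul continuous_subtype_val) (hne hρ)).clm_apply
      continuous_subtype_val
  have hint : ∀ {ρ : ℝ}, 0 < ρ →
      Integrable (fun θ : sphere (0 : E) 1 => f (ρ • (θ : E))) (volume : Measure E).toSphere :=
    fun hρ => (hslice hρ).integrable_of_hasCompactSupport (HasCompactSupport.of_compactSpace _)
  have hmeas : ∀ᶠ ρ in 𝓝 r, AEStronglyMeasurable (fun θ : sphere (0 : E) 1 => f (ρ • (θ : E)))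
      (volume : Measure E).toSphere := by
    filter_upwards [hs] with ρ hρ
    exact (hslice (lt_trans (by positivity) hρ.1)).aestronglyMeasurable
  refine (hasDerivAt_integral_of_dominated_loc_of_deriv_le (μ := (volume : Measure E).toSphere)
    (F := fun (ρ : ℝ) (θ : sphere (0 : E) 1) => f (ρ • (θ : E)))
    (F' := fun (ρ : ℝ) (θ : sphere (0 : E) 1) => fderiv ℝ f (ρ • (θ : E)) (θ : E))
    (bound := fun _ => max C 0) hs hmeas (hint hr) (hslice' hr).aestronglyMeasurable ?_
    (integrable_const _) ?_).2
  · refine ae_of_all _ fun θ ρ hρ => ?_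
    calc ‖fderiv ℝ f (ρ • (θ : E)) (θ : E)‖ ≤ ‖fderiv ℝ f (ρ • (θ : E))‖ * ‖(θ : E)‖ :=
          ContinuousLinearMap.le_opNorm _ _
      _ ≤ max C 0 * 1 := by
          rw [norm_eq_of_mem_sphere θ]
          exact mul_le_mul ((hC _ (hmem hρ θ)).trans (le_max_left _ _)) le_rfl zero_le_one
            (le_max_right _ _)
      _ = max C 0 := mul_one _
  · refine ae_of_all _ fun θ ρ hρ => ?_
    have h1 : HasDerivAt (fun ρ : ℝ => ρ • (θ : E)) ((1 : ℝ) • (θ : E)) ρ :=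
      (hasDerivAt_id ρ).smul_const (θ : E)
    rw [one_smul] at h1
    exact (hfd _ (hK0 (hmem hρ θ))).comp_hasDerivAt ρ h1

/-- The same with the radial derivative `∂ᵣf(x) = Df(x)(x/‖x‖)`: for `f` of class `C¹` on `{0}ᶜ`
and `r > 0`, `d/dr sphereIntegral f r = sphereIntegral (∂ᵣf) r`. [folklore] -/
theorem hasDerivAt_sphereIntegral_radial_of_contDiffOn [Nontrivial E] {f : E → ℝ}
    (hf : ContDiffOn ℝ 1 f {0}ᶜ) {r : ℝ} (hr : 0 < r) :
    HasDerivAt (Literature.Analysis.FluidPDE.sphereIntegral (volume : Measure E) f)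
      (Literature.Analysis.FluidPDE.sphereIntegral (volume : Measure E)
        (fun x => fderiv ℝ f x (‖x‖⁻¹ • x)) r) r := by
  have h := hasDerivAt_sphereIntegral_of_contDiffOn hf hr
  have heq : Literature.Analysis.FluidPDE.sphereIntegral (volume : Measure E)
      (fun x => fderiv ℝ f x (‖x‖⁻¹ • x)) r =
      ∫ θ : sphere (0 : E) 1, fderiv ℝ f (r • (θ : E)) (θ : E) ∂(volume : Measure E).toSphere := by
    rw [Literature.Analysis.FluidPDE.sphereIntegral_def]
    refine integral_congr_ae (ae_of_all _ fun θ => ?_)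
    simp only [Literature.Analysis.FluidPDE.norm_smul_sphere hr.le θ, smul_smul,
      inv_mul_cancel₀ hr.ne', one_smul]
  rw [heq]
  exact h

/-- **Differentiating a spherical integral in a parameter.** Let `𝒯` be open and
`q : ℝ → E → ℝ` jointly `C¹` on `𝒯 × {0}ᶜ` (as a function of `(t, x)`). Then for `r > 0` and
`t ∈ 𝒯`, `s ↦ ∫_S q(s, rθ) dσ(θ)` has derivative `∫_S ∂ₜq(t, rθ) dσ(θ)` at `t`, where
`∂ₜq(t, x) = D q̄(t, x)(1, 0)`. [folklore] -/
theorem hasDerivAt_sphereIntegral_param [Nontrivial E] {q : ℝ → E → ℝ} {𝒯 : Set ℝ}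
    (h𝒯 : IsOpen 𝒯) (hq : ContDiffOn ℝ 1 (fun p : ℝ × E => q p.1 p.2) (𝒯 ×ˢ ({0}ᶜ : Set E)))
    {r : ℝ} (hr : 0 < r) {t : ℝ} (ht : t ∈ 𝒯) :
    HasDerivAt (fun s => Literature.Analysis.FluidPDE.sphereIntegral (volume : Measure E) (q s) r)
      (∫ θ : sphere (0 : E) 1, fderiv ℝ (fun p : ℝ × E => q p.1 p.2) (t, r • (θ : E)) ((1 : ℝ), (0 : E))
        ∂(volume : Measure E).toSphere) t := by
  have hO : IsOpen (𝒯 ×ˢ ({0}ᶜ : Set E)) := h𝒯.prod isOpen_compl_singleton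
  set Q : ℝ × E → ℝ := fun p => q p.1 p.2 with hQ
  have hQd : ∀ p ∈ 𝒯 ×ˢ ({0}ᶜ : Set E), HasFDerivAt Q (fderiv ℝ Q p) p := fun p hp =>
    ((hq.differentiableOn one_ne_zero).differentiableAt (hO.mem_nhds hp)).hasFDerivAt
  have hQc : ContinuousOn Q (𝒯 ×ˢ ({0}ᶜ : Set E)) := hq.continuousOn
  have hDQc : ContinuousOn (fun p => fderiv ℝ Q p) (𝒯 ×ˢ ({0}ᶜ : Set E)) :=
    hq.continuousOn_fderiv_of_isOpen hO le_rfl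
  -- a compact time interval around `t` inside `𝒯` and the sphere of radius `r`
  obtain ⟨ε, hε, hball⟩ := Metric.mem_nhds_iff.mp (h𝒯.mem_nhds ht)
  have hIcc : Icc (t - ε / 2) (t + ε / 2) ⊆ 𝒯 := fun s hs =>
    hball (by rw [Metric.mem_ball, Real.dist_eq, abs_lt]; constructor <;> linarith [hs.1, hs.2])
  have hne : ∀ θ : sphere (0 : E) 1, r • (θ : E) ∈ ({0}ᶜ : Set E) := by
    intro θ
    simp only [mem_compl_iff, mem_singleton_iff, smul_eq_zero, not_or]
    exact ⟨hr.ne', ne_zero_of_mem_unit_sphere θ⟩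
  set K : Set (ℝ × E) := Icc (t - ε / 2) (t + ε / 2) ×ˢ ((fun θ : sphere (0 : E) 1 => r • (θ : E)) '' univ)
    with hK
  have hKc : IsCompact K := isCompact_Icc.prod
    ((isCompact_univ.image (continuous_const.smul continuous_subtype_val)))
  have hKsub : K ⊆ 𝒯 ×ˢ ({0}ᶜ : Set E) := by
    rintro ⟨s, y⟩ ⟨hs, ⟨θ, -, rfl⟩⟩
    exact ⟨hIcc hs, hne θ⟩
  have hDQv : ContinuousOn (fun p => fderiv ℝ Q p ((1 : ℝ), (0 : E))) (𝒯 ×ˢ ({0}ᶜ : Set E)) :=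
    hDQc.clm_apply continuousOn_const
  obtain ⟨C, hC⟩ := hKc.exists_bound_of_continuousOn (hDQv.mono hKsub)
  have hs : Ioo (t - ε / 2) (t + ε / 2) ∈ 𝓝 t := Ioo_mem_nhds (by linarith) (by linarith)
  -- continuity of the slices in `θ`
  have hinK : ∀ {s : ℝ}, s ∈ Icc (t - ε / 2) (t + ε / 2) → ∀ θ : sphere (0 : E) 1, (s, r • (θ : E)) ∈ K :=
    fun hs θ => ⟨hs, ⟨θ, mem_univ _, rfl⟩⟩
  have hslice : ∀ {s : ℝ}, s ∈ 𝒯 → Continuous fun θ : sphere (0 : E) 1 => q s (r • (θ : E)) := by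
    intro s hs
    have h : Continuous fun θ : sphere (0 : E) 1 => Q (s, r • (θ : E)) :=
      hQc.comp_continuous (continuous_const.prodMk (continuous_const.smul continuous_subtype_val))
        fun θ => ⟨hs, hne θ⟩
    exact h
  have hslice' : Continuous fun θ : sphere (0 : E) 1 =>
      fderiv ℝ Q (t, r • (θ : E)) ((1 : ℝ), (0 : E)) :=
    (hDQc.comp_continuous (continuous_const.prodMk (continuous_const.smul continuous_subtype_val))
      fun θ => ⟨ht, hne θ⟩).clm_apply continuous_const
  have hint : Integrable (fun θ : sphere (0 : E) 1 => q t (r • (θ : E))) (volume : Measure E).toSphere :=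
    (hslice ht).integrable_of_hasCompactSupport (HasCompactSupport.of_compactSpace _)
  have hmeas : ∀ᶠ s in 𝓝 t, AEStronglyMeasurable (fun θ : sphere (0 : E) 1 => q s (r • (θ : E)))
      (volume : Measure E).toSphere := by
    filter_upwards [h𝒯.mem_nhds ht] with s hs
    exact (hslice hs).aestronglyMeasurable
  have h := (hasDerivAt_integral_of_dominated_loc_of_deriv_le (μ := (volume : Measure E).toSphere)
    (F := fun (s : ℝ) (θ : sphere (0 : E) 1) => q s (r • (θ : E)))
    (F' := fun (s : ℝ) (θ : sphere (0 : E) 1) => fderiv ℝ Q (s, r • (θ : E)) ((1 : ℝ), (0 : E)))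
    (bound := fun _ => max C 0) hs hmeas hint hslice'.aestronglyMeasurable ?_
    (integrable_const _) ?_).2
  · simpa [Literature.Analysis.FluidPDE.sphereIntegral] using h
  · refine ae_of_all _ fun θ s hs' => ?_
    exact (hC _ (hinK ⟨hs'.1.le, hs'.2.le⟩ θ)).trans (le_max_left _ _)
  · refine ae_of_all _ fun θ s hs' => ?_
    have hp : (s, r • (θ : E)) ∈ 𝒯 ×ˢ ({0}ᶜ : Set E) := ⟨hIcc ⟨hs'.1.le, hs'.2.le⟩, hne θ⟩
    have h1 : HasDerivAt (fun s' : ℝ => ((s', r • (θ : E)) : ℝ × E)) ((1 : ℝ), (0 : E)) s := by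
      have := (hasDerivAt_id s).prodMk (hasDerivAt_const s (r • (θ : E)))
      simpa using this
    exact (hQd _ hp).comp_hasDerivAt s h1

end Literature.Analysis.Calculus
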